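import Summits.BirchSwinnertonDyer.BirchSwinnertonDyer.Theses.SmallImageMuTransfer
import Summits.BirchSwinnertonDyer.Rank1Residual.X10.CoreTheoremAOddPrimeHolds
import Summits.BirchSwinnertonDyer.Rank1Residual.X9.SurjKatoCertificateRoute
import HarnessLib

/-!
# The parent crux `MuTransfer` of route `SmallImageMuTransfer` (stmt-BirchSwinnertonDyer-19629) BY NAME
# modulo F1 ALONE — the six published inputs of `MuTransferInputs` leave the cone of the parent

Cell `bsd-smallim`, seat `bsd-smallim-k6-c2` (gen 6, lead of the line `MuTransfer → MuTransferX9`), rung K6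
of `BirchSwinnertonDyer` (leaf `Rank1Residual.BSDpOnClassX9`).  HONEST FRAMING: proves no case of BSD and
closes no item — 19629 is unconditional and stays OPEN by design until the ONE published construction fact
F1 = `Kato2004.exists_divisibilityInputs_fineQuotient_zeta` (Kato 2004 Thm. 12.5/12.6 zeta-element package
with the fine quotient (14.9.3)/(17.13.1) and the Thm. 12.6 span clause; aside item 19843) has a `_holds`;
the gate records a `conditional-result`.  PARTITION (D-0054): X9 (A4; good-ordinary `p ∈ {5,7}`, `ρ̄`
irreducible ∧ ¬surjective; book230 0 open cells, class-wide 790 pairs) — types-the-object-of A4; closes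
NONE; bears_on: K6 (route-BirchSwinnertonDyer-SmallImageMuTransfer item 19629).

## What is new (one observation, then bookkeeping)

The parent statement `MuTransfer := Rank1Residual.KatoMuTransfer` — for `E/ℚ` on a global minimal model,
`p ≥ 5` good ordinary with `E[p]` irreducible (surjective OR NOT, CM OR NOT), `f` a newform of `E`: one
`p`-adic unit coefficient of `L_p(f, α, T)` forces `μ(X(E/ℚ_∞)) = 0` for every cyclotomic dual datum — was
of record modulo F1 AND the six published inputs of the sibling `MuTransferInputs` (19277: Kato Thm. 17.4,
Burungale–Castella–Skinner (a), Rubin 1991 Thm. 12.3, Greenberg–Vatsal Thm. 1.4, the period unit A25,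
Carayol), through the glue `MuTransferSplit` (excluded middle on surjectivity, then on CM):
`Theorems.smallImageMuTransfer_MuTransfer_of_kato` (x10 g40, p481058).  NONE of the six is needed:

* **the non-surjective branch, CM INCLUDED, is F1 alone** — the typed core of the cell's Theorem A,
  `X10.CoreTheoremAOddPrime`, HOLDS (`X10.coreTheoremAOddPrime_holds`, cells `bsd-smallim` + `b2b-bsdres`,
  F2 = Kato §13.8 and F3 = Poitou–Tate over `ℚ` being tree theorems) at EVERY odd good-ordinary prime with
  `E[p]` irreducible and `ρ̄` not surjective, and carries NO `¬CM` hypothesis; its consumer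
  `X10.mu_eq_zero_of_fine (hfine : F1)` is the `μ`-transfer on that whole branch — so Rubin 12.3, GV 1.4,
  A25 and Carayol (the CM helper `smallImageMuTransfer_stub_cm_of_rubin_of_gv`, p417975) are not needed;
* **the surjective branch is F1 alone** — (i) Kato's Thm. 17.4 at the datum (the tree's named fact
  `kato_divisibility W p`) is DERIVED from F1 (`smallImageMuTransfer_kato_divisibility_of_fine`): the
  proved §17.13 module theory `Kato2004.kato_divisibility_body_of_skeleton` wants `𝐇¹` torsion free of
  `Λ`-rank `≤ 1` (Kato Thm. 12.4 (2), the tree's fact `Kato2004.thm12_4` in `kato_divisibility_of_inputs`),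
  which the F1 package gives for free: `col ∘ loc : 𝐇¹ → P → Λ` is injective ((17.13.2) + Prop. 17.11),
  so `𝐇¹` embeds in `Λ`; (ii) clause (3) of `kato_divisibility` under `ρ̄_{E,p^m}` onto for all `m`
  (Serre IV-23 from `surj(p)` and `p ≥ 5`, tree `hasSurjectiveModNGaloisRep_pow_of_surj`) gives
  `g₁ ∈ char_Λ X` with `ι g₁ = L_p(f, α)`; the characteristic ideal of ANY `Λ`-module is principal
  (tree theorem `charIdeal_isPrincipal_holds`, `Λ` a UFD — this replaces BCS (a), which the older route
  `X9.SurjKatoCertificateRoute.mu_eq_zero_of_surj_of_kato_of_unitCoeff` used only to name a generator),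
  say `char_Λ X = (g₀)`; the unit coefficient makes `μ(g₁) = 0`, hence `μ(g₀) = 0`
  (`hasUnitContent_of_mem_span_singleton`), i.e. `μ(X) = 0` (`GreenbergVatsal2000.mu_eq_zero_iff_hasUnitContent`,
  `X` torsion by clause (1)).

Hence **`smallImageMuTransfer_MuTransfer_of_fine (hfineZ : F1) : Theses.SmallImageMuTransfer.MuTransfer`**
(the parent item BY NAME modulo exactly ONE published named fact — the same footing as the deciding child
`MuTransferX9`, x10 g40 `smallImageMuTransfer_MuTransferX9_of_fine`, p480374) and its
`Rank1Residual.KatoMuTransfer` spelling.  The rung-K6 leaf modulo F1, the route's two named conjectures and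
`PublishedInputsX9` is already the tree's `smallImageMuTransfer_bsdpOnClassX9_of_kato` (x10 g40, p481058, from
the child); through the route's own chain `Assembly` (19633) it is `smallImageMuTransfer_Assembly_proof
(smallImageMuTransfer_MuTransfer_of_fine hfineZ)` — the same statement, not restated here.

Consequence for the planner (not this seat's call): the sibling support item `MuTransferInputs` (19277,
cite-only, six conjuncts) is no longer load-bearing for 19629; the parent closes by
`smallImageMuTransfer_MuTransfer_of_fine Kato2004.exists_divisibilityInputs_fineQuotient_zeta_holds` the day F1
is discharged.  Nothing here is stronger than what the F1 package prints: its field `integral` is Kato's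
Thm. 12.5 (4) with 17.4 (3) under the surjectivity hypothesis of `kato_divisibility` (3), typed verbatim as
the `hint` binder of `kato_divisibility_body_of_skeleton` precisely so that the package discharges
`kato_divisibility` (`Kato2004.DivisibilityInputs` module docstring, "a discharge road for `kato_divisibility`").

References: K. Kato, Astérisque 295 (2004) Thm. 12.4, Thm. 12.5 (4), Thm. 12.6, Ex. 13.3, §13.8, Thm. 17.4,
Prop. 17.11, §17.13 (pp. 279–280) [Kato2004Asterisque]; J.-P. Serre, *Abelian ℓ-adic representations* (1968)
IV-23 [SerreAbelianLadic1968]; R. Greenberg, V. Vatsal, Invent. Math. 142 (2000) (1)–(2), Prop. 3.7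
[GreenbergVatsal2000]; L. Washington, *Introduction to Cyclotomic Fields* §13.2 [Washington1997];
HOME/koly/KOLY-MEMO.md v1.8 Thm. 5.7.1 / Cor. 5.7.2, MU-TRANSFER-PROOF.md Theorem A / Cor. B.
-/

-- the summit and its single problem are both named `BirchSwinnertonDyer` (registry layout D-0017)
set_option linter.dupNamespace false
set_option autoImplicit false

noncomputable section

open scoped Classical MatrixGroups ModularForm NumberField
open CongruenceSubgroup WeierstrassCurve Field
open Literature.NumberTheory.GaloisRepresentations
open Literature.NumberTheory.EllipticCurves Literature.NumberTheory.EllipticCurves.ModularForms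
open Literature.NumberTheory.EllipticCurves.Kato2004
open Literature.NumberTheory.EllipticCurves.Rank1Residual
open Summit.BirchSwinnertonDyer.BirchSwinnertonDyer.Rank1Residual
open Summit.BirchSwinnertonDyer.BirchSwinnertonDyer.Theses.SmallImageMuTransfer
open Summit.BirchSwinnertonDyer.Rank1Residual (hasSurjectiveModNGaloisRep_pow_of_surj
  hasUnitContent_of_mem_span_singleton)

namespace Summit.BirchSwinnertonDyer.BirchSwinnertonDyer.Theorems

/-! ## Kato's Thm. 17.4 at every cyclotomic datum from F1 alone (no Thm. 12.4 binder) -/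

/-- **Kato's Thm. 17.4 for `T_pE` (the tree's named fact `kato_divisibility W p`, every cyclotomic datum and
newform) FROM F1 ALONE.**  `Kato2004.kato_divisibility_of_inputs` composed the proved §17.13 module theory
`kato_divisibility_body_of_skeleton` with three facts — (12.2.1) datum existence (now the tree theorem
`nonempty_iwasawaH1Data_holds`), the package (from F1 by `X10.exists_divisibilityInputs_of_fineQuotient_zeta`)
and Kato Thm. 12.4 (2) (`𝐇¹` torsion free of rank `≤ 1`).  The last is read off the package itself:
`loc : 𝐇¹ → P` is injective ((17.13.2)) and the Coleman map `col : P → Λ` is injective (Prop. 17.11), so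
`𝐇¹ ↪ Λ` is torsion free (`Function.Injective.moduleIsTorsionFree`) of rank `≤ rank Λ = 1`
(`LinearMap.rank_le_of_injective`).  Conditional on F1 only; nothing asserted.
[cite: Kato2004Asterisque, Thm. 12.5 (4), Thm. 12.6 (p. 222), Thm. 17.4 (p. 273), Prop. 17.11 (p. 277) and §17.13 (pp. 279–280)] -/
theorem smallImageMuTransfer_kato_divisibility_of_fine
    (hfineZ : exists_divisibilityInputs_fineQuotient_zeta) (W : WeierstrassCurve ℚ) [W.IsElliptic]
    [W.IsGloballyMinimal] (p : ℕ) [Fact p.Prime] {κ : ZpExtension ℚ p} {γ : absoluteGaloisGroup ℚ}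
    {N : ℕ} [NeZero N] {f : CuspForm (Gamma0 N) 2} :
    kato_divisibility W p (κ := κ) (γ := γ) (f := f) := by
  intro hp hord hκ hγ hγ' hf D
  haveI : ContinuousSMul ℤ_[p] (W.tateModule p) := TateModule.continuousSMul_padicInt
  obtain ⟨I⟩ := nonempty_iwasawaH1Data_holds W p κ γ hκ hγ
  obtain ⟨K⟩ := Summit.BirchSwinnertonDyer.Rank1Residual.X10.exists_divisibilityInputs_of_fineQuotient_zeta
    hfineZ W p f κ γ hp hord hκ hγ hγ' hf I D
  -- Thm. 12.4 (2) for free: `col ∘ loc : 𝐇¹ ↪ Λ`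
  have hinj : Function.Injective (K.col ∘ₗ K.loc) := K.col_injective.comp K.loc_injective
  haveI : Module.IsTorsionFree (IwasawaAlgebra p) I.H :=
    Function.Injective.moduleIsTorsionFree (K.col ∘ₗ K.loc) hinj fun r m => map_smul _ r m
  have hrank : Module.rank (IwasawaAlgebra p) I.H ≤ 1 :=
    (LinearMap.rank_le_of_injective _ hinj).trans_eq (Module.rank_self _)
  haveI := K.finite_H2loc
  exact kato_divisibility_body_of_skeleton W p hord hf hκ hγ D hrank K.loc K.toX K.δ K.exact_P
    K.exact_X K.col K.col_injective K.isTorsion_H2 K.Z K.pow_mem K.es_bound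
    (fun 𝔭 _ hp𝔭 ↦ lengthAt_eq_zero_of_finite_of_C_not_mem K.H2loc 𝔭 hp𝔭) K.ιG_eq K.integral

/-! ## The surjective branch from F1 alone (no BCS (a), no Thm. 17.4 / 12.4 binder) -/

/-- **Greenberg's `μ(X(E/ℚ_∞)) = 0` on the SURJECTIVE good-ordinary cell at `p ≥ 5` from F1 and one unit
coefficient of `L_p(f, α)` — no Burungale–Castella–Skinner, no separate Kato binder.**  Kato's clause (3)
(`smallImageMuTransfer_kato_divisibility_of_fine`, with `ρ̄_{E,p^m}` onto for all `m` by
`hasSurjectiveModNGaloisRep_pow_of_surj`) gives `g₁ ∈ char_Λ X` with `ι g₁ = L_p(f, α)`; `char_Λ X = (g₀)` is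
principal for EVERY `Λ`-module (`charIdeal_isPrincipal_holds`; the older route
`X9.mu_eq_zero_of_surj_of_kato_of_unitCoeff` took the generator from BCS (a)); the certificate makes
`μ(g₁) = 0`, so `μ(g₀) = 0` (`hasUnitContent_of_mem_span_singleton`), i.e. `μ(X) = 0`
(`GreenbergVatsal2000.mu_eq_zero_iff_hasUnitContent`, `X` torsion by clause (1)).
[cite: Kato2004Asterisque, Thm. 12.5 (4) (p. 222) and Thm. 17.4 (3) (p. 273)]
[cite: SerreAbelianLadic1968, Ch. IV §3.4 Lemma 3 (IV-23)] [cite: GreenbergVatsal2000, p. 2, (1)–(2)]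
[cite: Washington1997, §13.2] -/
theorem smallImageMuTransfer_mu_eq_zero_of_surj_of_fine
    (hfineZ : exists_divisibilityInputs_fineQuotient_zeta) (W : WeierstrassCurve ℚ) [W.IsElliptic]
    [W.IsGloballyMinimal] (p : ℕ) [Fact p.Prime] (hp : 5 ≤ p) (hgood : W.HasGoodReductionAtPrime p)
    (hap : ¬ (p : ℤ) ∣ W.frobeniusTrace p) (hsurj : W.HasSurjectiveModNGaloisRep p)
    {N : ℕ} [NeZero N] (f : CuspForm (Gamma0 N) 2) (hf : IsNewformOf W f)
    (hcert : ∃ n : ℕ, ‖PowerSeries.coeff n (padicLFunction f (unitRoot W p : ℚ_[p]))‖ = 1)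
    (κ : ZpExtension ℚ p) (γ : absoluteGaloisGroup ℚ) (hκ : κ.IsCyclotomic)
    (hγ : κ.IsTopGenerator γ) (hγ' : IsCyclotomicVariable p γ) (D : W.SelmerDualData κ γ) :
    D.mu = 0 := by
  have hp2 : p ≠ 2 := by omega
  haveI : Module.Finite (IwasawaAlgebra p) D.X := D.module_finite_holds hγ
  -- Kato (1) and (3) at the datum, from F1
  obtain ⟨hX, -, h3⟩ :=
    smallImageMuTransfer_kato_divisibility_of_fine hfineZ W p (κ := κ) (γ := γ) (f := f) hp2
      ⟨hgood, hap⟩ hκ hγ hγ' hf D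
  obtain ⟨g₁, hg₁, hιg₁⟩ := h3 (hasSurjectiveModNGaloisRep_pow_of_surj hp hsurj)
  -- the characteristic ideal is principal (Λ is a UFD): no BCS needed to name a generator
  obtain ⟨g₀, hg₀⟩ := (charIdeal_isPrincipal_holds p D.X).principal
  have hchar : D.charIdeal = Ideal.span {g₀} := hg₀
  have hg₁u : GreenbergVatsal2000.HasUnitContent g₁ := hasUnitContent_of_map_eq g₁ _ hιg₁ hcert
  have hg₀u : GreenbergVatsal2000.HasUnitContent g₀ :=
    hasUnitContent_of_mem_span_singleton (hchar ▸ hg₁) hg₁u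
  exact (GreenbergVatsal2000.mu_eq_zero_iff_hasUnitContent D hX hchar).mpr hg₀u

/-! ## The parent item by name, modulo F1 alone -/

/-- **The parent crux `MuTransfer` (stmt-BirchSwinnertonDyer-19629), literally the route decl, modulo F1
ALONE.**  Excluded middle on `surj(p)`: the surjective branch is
`smallImageMuTransfer_mu_eq_zero_of_surj_of_fine` (F1 ⊢ Kato 17.4; principal characteristic ideal); the
non-surjective branch — CM or not — is the typed core of the cell's Theorem A at every odd prime,
`X10.mu_eq_zero_of_fine` (`X10.coreTheoremAOddPrime_holds`: Kato's `Λ`-adic Kolyvagin argument at one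
`E`-split Chebotarev prime; F2 = Kato §13.8 and F3 = Poitou–Tate over `ℚ` are tree theorems), which has no
`¬CM` hypothesis.  So the six published inputs of `MuTransferInputs` (Kato 17.4, BCS (a), Rubin 12.3, GV 1.4,
A25, Carayol) are OUT of the cone of 19629.  Conditional on the single published construction fact F1
(Kato 2004 Thm. 12.5/12.6 with Ex. 13.3, (14.9.3), Prop. 17.11, §17.13; item 19843); the item stays open until
`exists_divisibilityInputs_fineQuotient_zeta` is a theorem; nothing asserted; BSD not advanced.
[cite: Kato2004Asterisque, Thm. 12.5, Thm. 12.6 (p. 222), §13.8 (p. 228), Thm. 17.4 (3) (p. 273) and §17.13 (pp. 279–280)]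
[cite: GreenbergVatsal2000, Prop. 3.7] -/
theorem smallImageMuTransfer_MuTransfer_of_fine (hfineZ : exists_divisibilityInputs_fineQuotient_zeta) :
    Summit.BirchSwinnertonDyer.BirchSwinnertonDyer.Theses.SmallImageMuTransfer.MuTransfer := by
  unfold Summit.BirchSwinnertonDyer.BirchSwinnertonDyer.Theses.SmallImageMuTransfer.MuTransfer
    Summit.BirchSwinnertonDyer.BirchSwinnertonDyer.Rank1Residual.KatoMuTransfer
  intro W _ _ p _ N _ f hp hgood hap hirr hf hcert κ γ hκ hγ hγ' D
  by_cases hsurj : W.HasSurjectiveModNGaloisRep p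
  · exact smallImageMuTransfer_mu_eq_zero_of_surj_of_fine hfineZ W p hp hgood hap hsurj f hf hcert κ γ
      hκ hγ hγ' D
  · exact Summit.BirchSwinnertonDyer.Rank1Residual.X10.mu_eq_zero_of_fine hfineZ W p f (by omega) hgood
      hap hirr hsurj hf hcert κ γ hκ hγ hγ' D

/-- **The same statement under the tree's name `Rank1Residual.KatoMuTransfer`** (the head constant of item
19629 and the hypothesis of the rung-K6 kernel bridge `bsdpOnClassX9_of_katoMuTransfer`, p407118), modulo F1
ALONE; `MuTransfer` unfolds to it by `δ`.
[cite: Kato2004Asterisque, Thm. 12.5, Thm. 12.6 (p. 222), Thm. 17.4 (3) (p. 273) and §17.13 (pp. 279–280)] -/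
theorem smallImageMuTransfer_katoMuTransfer_of_fine (hfineZ : exists_divisibilityInputs_fineQuotient_zeta) :
    Summit.BirchSwinnertonDyer.BirchSwinnertonDyer.Rank1Residual.KatoMuTransfer :=
  smallImageMuTransfer_MuTransfer_of_fine hfineZ

end Summit.BirchSwinnertonDyer.BirchSwinnertonDyer.Theorems

end
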